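import Summits.AtomisticToContinuum.HydrodynamicLimit.Theorems.CollisionIsometryCLTAdaptedWeightCLTBHDVTransferHellinger

/-!
# Stub `stub_contactToMass` (S4) of the line `block-h-dissipation-closure`, helper file 3: range of the cell
dissipation and positivity of the regularised cell law
(crux `CollisionIsometryCLT.AdaptedWeightCLT`, stmt-AtomisticToContinuum-14868; `--supports`, anchor
`bhContactToMass_hellinger_anchor`)

Complements `…BHDVTransferHellinger` (S2's worker: `fluxZ_nonneg`, `hellDiss_nonneg`, `hellDiss_le_one` under
integrability of `B f f_*`, `hellDiss_localMaxwellian`) with what S4/S5 consume along the flow, where no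
integrability bookkeeping is wanted:
* `hellDiss_le_one'`: `𝒟h(f) ≤ 1` for EVERY measurable `f ≥ 0` (if `B f f_*` is not integrable, `Z(f)` is the
  junk `0` and so is `𝒟h(f)`), hence `hellDiss_mem_Icc`;
* the regularised cell law: `cW, kde, cT ≥ 0`, the Maxwellian floor `δ · M_{1, θ̄+h², ū} ≤ f̂` (`floor_le_cellLaw`),
  `f̂ ≥ 0` for `δ ∈ [0, 1]` and `f̂ > 0` for `δ ∈ (0, 1]`, `h ≠ 0`, continuity / measurability in the velocity;
* consequences for the line's functionals: `𝒟h(f̂_x) ∈ [0, 1]` (`hellDiss_cellLaw_mem_Icc`), `massDiss ≥ 0`,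
  `chaosDiss ≥ 0`, and the deterministic bound `massDiss ≤ ∫₀ᵗ ∫ₓ ρ̄` is left to the charging file.
No definitions.
-/

namespace Summit.AtomisticToContinuum.HydrodynamicLimit.Theorems.BlockHDissipation

open scoped BigOperators Topology Classical MeasureTheory ENNReal InnerProductSpace
open Filter Set MeasureTheory
open Literature.Analysis.FluidPDE
open Summit.AtomisticToContinuum.HydrodynamicLimit.Theorems.ContactSourceDuhamel (T3 V3 Cfg Vel Flow Flows)
open Summit.AtomisticToContinuum.HydrodynamicLimit.Theorems.ContactSourceDuhamel.TimeLocal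
open Literature.MathematicalPhysics.KineticTheory (hsDiameter localGibbsLaw collide hardSphereKernel
  sphereMeasure localMaxwellian_nonneg localMaxwellian_pos continuous_localMaxwellian)

noncomputable section

namespace ContactToMass

variable {N : ℕ}

/-! ## `𝒟h ≤ 1` without integrability bookkeeping -/

/-- **`𝒟h(f) ≤ 1`** for every measurable `f ≥ 0`: under integrability of `B f f_*` this is
`DVTransfer.hellDiss_le_one`; otherwise `Z(f) = 0` (junk Bochner integral) and `𝒟h(f) = 0⁻¹ · _ = 0`. -/
theorem hellDiss_le_one' {f : V3 → ℝ} (hf : Measurable f) (hf0 : ∀ v, 0 ≤ f v) : hellDiss f ≤ 1 := by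
  by_cases hint : Integrable (fun q : PairDir => hardSphereKernel q.1 q.2 * (f q.1.1 * f q.1.2)) pairDirMeasure
  · exact DVTransfer.hellDiss_le_one hf hf0 hint
  · have hZ : fluxZ f = 0 := integral_undef hint
    rw [hellDiss, hZ, mul_zero, inv_zero, zero_mul]
    exact zero_le_one

/-- `𝒟h(f) ∈ [0, 1]` for every measurable `f ≥ 0`. -/
theorem hellDiss_mem_Icc {f : V3 → ℝ} (hf : Measurable f) (hf0 : ∀ v, 0 ≤ f v) : hellDiss f ∈ Icc (0 : ℝ) 1 :=
  ⟨DVTransfer.hellDiss_nonneg hf0, hellDiss_le_one' hf hf0⟩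

/-! ## The regularised cell law is positive, continuous, measurable -/

section CellLaw

variable {ψ : ℕ → T3 → ℝ} (hψ : ∀ N y, 0 ≤ ψ N y)
include hψ

/-- Cell weights of a nonnegative kernel family are nonnegative (the weight IS a kernel value). -/
theorem cw_nonneg' (w : Cfg N) (x : T3) (i : Fin (N + 1)) : 0 ≤ cw N ψ w x i :=
  show 0 ≤ ψ N ((w i).1 - x) from hψ N _

/-- The total cell weight is nonnegative for a nonnegative kernel. -/
theorem cW_nonneg (w : Cfg N) (x : T3) : 0 ≤ cW N ψ w x :=
  Finset.sum_nonneg fun i _ => cw_nonneg' hψ w x i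

/-- The kernel density estimate is nonnegative. -/
theorem kde_nonneg (h : ℝ) (w : Cfg N) (x : T3) (v : V3) : 0 ≤ kde N ψ h w x v := by
  unfold kde gauss
  refine mul_nonneg (inv_nonneg.2 (cW_nonneg hψ w x)) (Finset.sum_nonneg fun i _ => ?_)
  exact mul_nonneg (cw_nonneg' hψ w x i) (localMaxwellian_nonneg zero_le_one (sq_nonneg h) _ _)

/-- The cell temperature is nonnegative. -/
theorem cT_nonneg (w : Cfg N) (x : T3) : 0 ≤ cT N ψ w x := by
  unfold cT
  refine mul_nonneg (inv_nonneg.2 (cW_nonneg hψ w x)) (Finset.sum_nonneg fun i _ => ?_)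
  exact mul_nonneg (cw_nonneg' hψ w x i) (by positivity)

/-- **The Maxwellian floor**: `δ · M_{1, θ̄ + h², ū}(v) ≤ f̂(v)` for `δ ≤ 1`. -/
theorem floor_le_cellLaw {δ : ℝ} (hδ1 : δ ≤ 1) (h : ℝ) (w : Cfg N) (x : T3) (v : V3) :
    δ * localMaxwellian 1 (cT N ψ w x + h ^ 2) (cU N ψ w x) v ≤ cellLaw N ψ h δ w x v := by
  unfold cellLaw
  have h1 : 0 ≤ (1 - δ) * kde N ψ h w x v := mul_nonneg (by linarith) (kde_nonneg hψ h w x v)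
  linarith

/-- The regularised cell law is nonnegative for `δ ∈ [0, 1]`. -/
theorem cellLaw_nonneg {δ : ℝ} (hδ0 : 0 ≤ δ) (hδ1 : δ ≤ 1) (h : ℝ) (w : Cfg N) (x : T3) (v : V3) :
    0 ≤ cellLaw N ψ h δ w x v := by
  refine le_trans (mul_nonneg hδ0 (localMaxwellian_nonneg zero_le_one ?_ _ _)) (floor_le_cellLaw hψ hδ1 h w x v)
  exact add_nonneg (cT_nonneg hψ w x) (sq_nonneg h)

/-- The regularised cell law is strictly positive for `δ ∈ (0, 1]`, `h ≠ 0`. -/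
theorem cellLaw_pos {δ : ℝ} (hδ0 : 0 < δ) (hδ1 : δ ≤ 1) {h : ℝ} (hh : h ≠ 0) (w : Cfg N) (x : T3) (v : V3) :
    0 < cellLaw N ψ h δ w x v := by
  refine lt_of_lt_of_le (mul_pos hδ0 (localMaxwellian_pos zero_lt_one ?_ _ _)) (floor_le_cellLaw hψ hδ1 h w x v)
  exact add_pos_of_nonneg_of_pos (cT_nonneg hψ w x) (by positivity)

omit hψ in
/-- The kernel density estimate is continuous in the velocity. -/
theorem continuous_kde (h : ℝ) (w : Cfg N) (x : T3) : Continuous (kde N ψ h w x) := by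
  unfold kde gauss
  refine continuous_const.mul (continuous_finsetSum _ fun i _ => ?_)
  exact continuous_const.mul (continuous_localMaxwellian _ _ _)

omit hψ in
/-- The regularised cell law is continuous in the velocity. -/
theorem continuous_cellLaw (h δ : ℝ) (w : Cfg N) (x : T3) : Continuous (cellLaw N ψ h δ w x) := by
  unfold cellLaw
  exact (continuous_const.mul (continuous_kde h w x)).add (continuous_const.mul (continuous_localMaxwellian _ _ _))

omit hψ in
/-- The regularised cell law is measurable in the velocity. -/
theorem measurable_cellLaw (h δ : ℝ) (w : Cfg N) (x : T3) : Measurable (cellLaw N ψ h δ w x) :=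
  (continuous_cellLaw h δ w x).measurable

/-- **Range of the cell dissipation**: `𝒟h(f̂_x) ∈ [0, 1]` for a nonnegative kernel and `δ ∈ [0, 1]`. -/
theorem hellDiss_cellLaw_mem_Icc {δ : ℝ} (hδ0 : 0 ≤ δ) (hδ1 : δ ≤ 1) (h : ℝ) (w : Cfg N) (x : T3) :
    hellDiss (cellLaw N ψ h δ w x) ∈ Icc (0 : ℝ) 1 :=
  hellDiss_mem_Icc (measurable_cellLaw h δ w x) (cellLaw_nonneg hψ hδ0 hδ1 h w x)

/-- The mass-weighted cell dissipation density is nonnegative. -/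
theorem cW_mul_hellDiss_nonneg {δ : ℝ} (hδ0 : 0 ≤ δ) (hδ1 : δ ≤ 1) (h : ℝ) (w : Cfg N) (x : T3) :
    0 ≤ ((N + 1 : ℕ) : ℝ)⁻¹ * cW N ψ w x * hellDiss (cellLaw N ψ h δ w x) :=
  mul_nonneg (mul_nonneg (by positivity) (cW_nonneg hψ w x)) (hellDiss_cellLaw_mem_Icc hψ hδ0 hδ1 h w x).1

/-- The mass-weighted cell dissipation density is at most the cell mass density `ρ̄ = W/(N+1)`. -/
theorem cW_mul_hellDiss_le {δ : ℝ} (hδ0 : 0 ≤ δ) (hδ1 : δ ≤ 1) (h : ℝ) (w : Cfg N) (x : T3) :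
    ((N + 1 : ℕ) : ℝ)⁻¹ * cW N ψ w x * hellDiss (cellLaw N ψ h δ w x) ≤ ((N + 1 : ℕ) : ℝ)⁻¹ * cW N ψ w x := by
  have h0 : 0 ≤ ((N + 1 : ℕ) : ℝ)⁻¹ * cW N ψ w x := mul_nonneg (by positivity) (cW_nonneg hψ w x)
  have h1 := (hellDiss_cellLaw_mem_Icc hψ hδ0 hδ1 h w x).2
  nlinarith

/-- `massDiss ≥ 0` (integrals of nonnegative functions). -/
theorem massDiss_nonneg {σ : ℝ} (Φ : Flow σ N) {h δ : ℝ} (hδ0 : 0 ≤ δ) (hδ1 : δ ≤ 1) (t : ℝ) (z : Cfg N) :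
    0 ≤ massDiss σ N Φ ψ h δ t z := by
  unfold massDiss
  exact integral_nonneg fun s => integral_nonneg fun x => cW_mul_hellDiss_nonneg hψ hδ0 hδ1 h _ x

/-- `chaosDiss ≥ 0` (a collision pair sum of nonnegative terms). -/
theorem chaosDiss_nonneg {σ : ℝ} (Φ : Flow σ N) {h δ : ℝ} (hδ0 : 0 ≤ δ) (hδ1 : δ ≤ 1) (t : ℝ) (z : Cfg N) :
    0 ≤ chaosDiss σ N Φ ψ h δ t z := by
  unfold chaosDiss HardSphereFlow.collisionPairSum
  refine collisionPairSum_nonneg fun s i j => ?_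
  dsimp only
  split_ifs
  · refine mul_nonneg (by positivity) (integral_nonneg fun x => ?_)
    exact mul_nonneg (add_nonneg (cw_nonneg' hψ _ x i) (cw_nonneg' hψ _ x j))
      (hellDiss_cellLaw_mem_Icc hψ hδ0 hδ1 h _ x).1
  · exact le_rfl

end CellLaw

end ContactToMass

/-- Registration anchor of this helper file (`--supports stmt-AtomisticToContinuum-14868`, stub
`stub_contactToMass`, file 3): the normalised Hellinger dissipation of the regularised cell law lies in `[0, 1]`
for every nonnegative kernel family and `δ ∈ [0, 1]` — the `∀`-closed form of
`ContactToMass.hellDiss_cellLaw_mem_Icc`. -/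
theorem bhContactToMass_hellinger_anchor : ∀ (N : ℕ) (ψ : ℕ → T3 → ℝ), (∀ N y, 0 ≤ ψ N y) →
    ∀ (h δ : ℝ), 0 ≤ δ → δ ≤ 1 → ∀ (w : Cfg N) (x : T3), hellDiss (cellLaw N ψ h δ w x) ∈ Icc (0 : ℝ) 1 :=
  fun _ _ hψ h _ hδ0 hδ1 w x => ContactToMass.hellDiss_cellLaw_mem_Icc hψ hδ0 hδ1 h w x

end

end Summit.AtomisticToContinuum.HydrodynamicLimit.Theorems.BlockHDissipation
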